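import Summits.AtomisticToContinuum.Crystallization.Theses.BrittleRungDescent

/-!
# `LocalHalesKernel → SoftLocalHales` (route BrittleRungDescent; bookkeeping transport)

Helper for item stmt-AtomisticToContinuum-10944 (`SoftLocalHales`, support of route
`AtomisticToContinuum/Crystallization/BrittleRungDescent`): the soft local-Hales statement with an
existential tolerance `η₀` follows from the effective kernel `LocalHalesKernel` (tolerance `1/400`,
crux stmt-AtomisticToContinuum-9208) with `η₀ = 1/400`, by pure bookkeeping.  Below the gap the
dichotomy "`dist ≤ 1 + η` or `63/50 ≤ dist`" at `u` and at each of its soft neighbours makes the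
neighbour sets and the soft contact relations at tolerance `η ≤ 1/400` and at tolerance `1/400`
coincide on the thirteen atoms, so the conclusion of the kernel transports along the identity
equivalence of the two (equal) neighbour subtypes.  No geometry is used.
-/

noncomputable section

namespace Summit.AtomisticToContinuum.Crystallization.Theorems

open Summit.AtomisticToContinuum.Crystallization.Theses.BrittleRungDescent

/-- **Tolerance monotonicity below the gap.**  If `u ∈ S` and every point of `S` within `1 + η`
of `u` is softly twelve-kissed with tolerance `η ≤ 1/400` and gap `63/50`, then the same holds
with tolerance `1/400`, the two soft neighbourhoods of `u` coincide, and so do the two soft contact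
relations on them; hence `LocalHalesKernel` (tolerance `1/400`) implies `SoftLocalHales` with
`η₀ = 1/400`. [folklore] -/
theorem softLocalHales_of_localHalesKernel (hK : LocalHalesKernel) : SoftLocalHales := by
  refine ⟨1 / 400, by norm_num, fun η hη hηle S u hu hyp => ?_⟩
  -- the soft contact relation at tolerance `η` and at `1/400` agree around every soft neighbour
  have key : ∀ v ∈ S, dist u v ≤ 1 + η → ∀ w ∈ S, w ≠ v →
      (dist v w ≤ 1 + η ↔ dist v w ≤ 1 + 1 / 400) := by
    intro v hv hvu w hw hwv
    refine ⟨fun h => by linarith, fun h => ?_⟩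
    rcases ((hyp v hv hvu).1 w hw hwv).2 with h' | h'
    · exact h'
    · linarith
  -- the two soft neighbourhoods of `u` agree
  have shellu : ∀ v ∈ S, (dist u v ≤ 1 + 1 / 400 ↔ dist u v ≤ 1 + η) := by
    intro v hv
    by_cases hvu : v = u
    · subst hvu
      simp only [dist_self]
      exact ⟨fun _ => by linarith, fun _ => by norm_num⟩
    · exact (key u hu (by rw [dist_self]; linarith) v hv hvu).symm
  -- the hypothesis of the kernel
  have hypK : ∀ v ∈ S, dist u v ≤ 1 + 1 / 400 →
      ((∀ w ∈ S, w ≠ v → 1 - 1 / 400 ≤ dist v w ∧ (dist v w ≤ 1 + 1 / 400 ∨ 63 / 50 ≤ dist v w)) ∧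
        {w ∈ S | w ≠ v ∧ dist v w ≤ 1 + 1 / 400}.ncard = 12) := by
    intro v hv hvu
    have hvu' : dist u v ≤ 1 + η := (shellu v hv).1 hvu
    obtain ⟨h1, h2⟩ := hyp v hv hvu'
    refine ⟨fun w hw hwv => ⟨by linarith [(h1 w hw hwv).1], ?_⟩, ?_⟩
    · rcases (h1 w hw hwv).2 with h | h
      · exact Or.inl (by linarith)
      · exact Or.inr h
    · rw [← h2]
      congr 1
      ext w
      simp only [Set.mem_setOf_eq]
      constructor
      · rintro ⟨hw, hwv, hd⟩
        exact ⟨hw, hwv, (key v hv hvu' w hw hwv).2 hd⟩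
      · rintro ⟨hw, hwv, hd⟩
        exact ⟨hw, hwv, (key v hv hvu' w hw hwv).1 hd⟩
  have concl := hK S u hu hypK
  -- transport along the identity equivalence of the two (equal) neighbour subtypes
  have hPQ : ∀ w : EuclideanSpace ℝ (Fin 3),
      (w ∈ S ∧ w ≠ u ∧ dist u w ≤ 1 + η) ↔ (w ∈ S ∧ w ≠ u ∧ dist u w ≤ 1 + 1 / 400) := by
    intro w
    constructor
    · rintro ⟨hw, hwu, hd⟩
      exact ⟨hw, hwu, (shellu w hw).2 hd⟩
    · rintro ⟨hw, hwu, hd⟩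
      exact ⟨hw, hwu, (shellu w hw).1 hd⟩
  set f : {w : EuclideanSpace ℝ (Fin 3) // w ∈ S ∧ w ≠ u ∧ dist u w ≤ 1 + η} ≃
      {w : EuclideanSpace ℝ (Fin 3) // w ∈ S ∧ w ≠ u ∧ dist u w ≤ 1 + 1 / 400} :=
    Equiv.subtypeEquivRight hPQ with hf
  have hf1 : ∀ w, (f w).1 = w.1 := fun w => rfl
  -- soft contacts between two neighbours of `u` agree at the two tolerances
  have adj : ∀ w w' : {w : EuclideanSpace ℝ (Fin 3) // w ∈ S ∧ w ≠ u ∧ dist u w ≤ 1 + η},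
      w ≠ w' → (dist w.1 w'.1 ≤ 1 + η ↔ dist w.1 w'.1 ≤ 1 + 1 / 400) := by
    intro w w' hne
    refine key w.1 w.2.1 w.2.2.2 w'.1 w'.2.1 ?_
    intro h
    exact hne (Subtype.ext h.symm)
  rcases concl with ⟨e, he⟩ | ⟨e, he⟩
  · left
    refine ⟨f.trans e, fun w w' hne => ?_⟩
    have hne' : f w ≠ f w' := fun h => hne (f.injective h)
    have h1 := he (f w) (f w') hne'
    rw [hf1, hf1] at h1
    rw [adj w w' hne]
    exact h1
  · right
    refine ⟨f.trans e, fun w w' hne => ?_⟩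
    have hne' : f w ≠ f w' := fun h => hne (f.injective h)
    have h1 := he (f w) (f w') hne'
    rw [hf1, hf1] at h1
    rw [adj w w' hne]
    exact h1

end Summit.AtomisticToContinuum.Crystallization.Theorems

end
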